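import Summits.HodgeConjecture.CorCM.GaloisCyclicSemidirectEightDifferencePairs
import HarnessLib

/-!
# `C₁₂₇ ⋊ C₈` is BAD: a CYCLOTOMIC difference pair in `ℤ/127` (`S = ⟨2⟩`, `S′ = {0} ∪ ⟨2⟩ ∪ 7⟨2⟩`)

COR-CM (cell `pub-hodgecm2`), binder seat b04 (gen 28), count-neutral claim CYCLIC-SEMIDIRECT-EIGHT-DEGENERATE, part IV-b — one more
instance of part III (`exists_simple_degenerate_of_differencePair`), at the Mersenne prime `p = 127 = 2·8² − 1` (group order `1016`,
abelian variety of dimension `508`).  STRUCTURE (found after the `p = 71` pair of part IV turned out to be affinely invariant under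
`x ↦ 5x + 1`): for `p = 2(B+1)² − 1` the admissible sizes are `(|S|, |S′|) = (B, 2B+1)` and `B ∣ p − 1`; taking `S = H` = the subgroup
of order `B` of `(ℤ/p)ˣ` and `S′ = {0} ∪ aH ∪ bH` a union of two `H`-cosets and the origin, the difference-pair identity holds for
suitable `(a, b)` when `B ∈ {1, 3, 5, 7}` (`p = 7, 31, 71, 127`; `6, 2, 2, 4` coset pairs) and for NO coset pair when
`B ∈ {9, 12, 17, 20, 21, 23, 27, 33, 35, 37, 41}` (`p = 199, 337, 647, …`; seat census `scratch-g28`) — so this is an instance, not yet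
a family.  Here `B = 7`, `H = ⟨2⟩ = {1,2,4,8,16,32,64}` (as `2⁷ ≡ 1`), `(a,b) = (1,7)`: `S′ = {0} ∪ H ∪ 7H`.  Checked by `decide` on
`ℤ/127` alone.  KERNEL ONLY: theorems; no definition, no named fact, no `sorry`.  `HC_CM` is neither used nor claimed.

## References

* [Shimura1998] G. Shimura, *Abelian Varieties with Complex Multiplication and Modular Functions*, §6.2 Thm. 3, §8.2 Prop. 26.
* [Gordon1999HodgeAVSurvey] B. B. Gordon, *A survey of the Hodge conjecture for abelian varieties*, Thm. 6.4, §9.3.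
-/

noncomputable section

open CategoryTheory CategoryTheory.Limits NumberField
open scoped BigOperators

namespace Summit.HodgeConjecture.CorCM.GaloisCyclicSemidirectEight

open Literature.NumberTheory.ComplexMultiplication
open Literature.AlgebraicGeometry.Motives (AbelianVariety CMType)
open Literature.AlgebraicGeometry.HodgeTheory
open Literature.AlgebraicGeometry.ComplexMultiplication (IsCMTypeRealisation)
open Literature.AlgebraicGeometry.Pohlmann1968
open Literature.Barriers.HodgeConjecture (divisorClassesSpan)

variable {K : Type} [Field K] [NumberField K] [IsCMField K] [IsGalois ℚ K]

set_option maxRecDepth 16000 in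
set_option maxHeartbeats 4000000 in
/-- **`Gal(K/ℚ) ≅ C₁₂₇ ⋊ C₈` is BAD**: the cyclotomic difference pair `S = ⟨2⟩ = {1,2,4,8,16,32,64}`, `S′ = {0} ∪ ⟨2⟩ ∪ 7⟨2⟩` in `ℤ/127`
gives a simple DEGENERATE abelian `508`-fold with CM by `K` and a rational `(q,q)` class outside the divisor ring on some power.
[cite: Shimura1998, §6.2 Thm. 3 and §8.2 Prop. 26] [cite: Gordon1999HodgeAVSurvey, Thm. 6.4 and §9.3] -/
theorem exists_simple_degenerate_cyclic127_semidirect8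
    (φ : Multiplicative (ZMod 8) →* MulAut (Multiplicative (ZMod 127)))
    (hφ : ∀ v : Multiplicative (ZMod 127), φ (Multiplicative.ofAdd 1) v = v⁻¹)
    (e : (K ≃ₐ[ℚ] K) ≃* Multiplicative (ZMod 127) ⋊[φ] Multiplicative (ZMod 8)) :
    ∃ (Φ : CMType K) (φ₀ : K →+* ℂ) (A : AbelianVariety ℂ) (ι : 𝓞 K →+* End A)
      (θ : K →+* Module.End ℂ (complexBetti A.X 1)),
      IsPrimitive (ℂ ≃+* ℂ) Φ.1 φ₀ ∧ ¬ IsNondegenerate Φ ∧ IsCMTypeRealisation Φ A ι θ ∧ A.IsSimple ∧ A.dim = 508 ∧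
      ∃ n q : ℕ, ∃ x : complexBetti (⨁ fun _ : Fin n => A).X (2 * q), IsRationalClass x ∧
        IsOfHodgeType (⨁ fun _ : Fin n => A).dim (⨁ fun _ : Fin n => A).X (2 * q) q q x ∧
        x ∉ divisorClassesSpan (⨁ fun _ : Fin n => A).X (⨁ fun _ : Fin n => A).dim q := by
  obtain ⟨Φ, φ₀, A, ι, θ, h1, h2, h3, h4, h5, h6⟩ := @exists_simple_degenerate_of_differencePair 127 ⟨by norm_num⟩ K _ _ _ _
    (by norm_num) φ hφ e {1, 2, 4, 8, 16, 32, 64} {0, 1, 2, 4, 7, 8, 14, 16, 28, 32, 56, 64, 67, 97, 112}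
    ⟨1, by decide⟩ ⟨0, by decide⟩ (by decide)
  exact ⟨Φ, φ₀, A, ι, θ, h1, h2, h3, h4, by norm_num at h5; exact h5, h6⟩

end Summit.HodgeConjecture.CorCM.GaloisCyclicSemidirectEight

end
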